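import Summits.Ventures.PercRepro.GenQLargeSevenAll
import Summits.Ventures.PercRepro.GenQCoreChain
import Summits.Ventures.PercRepro.GenQEightSixAssembly

/-!
# PercRepro — THE `(9, 7)` ROW REDUCED TO ITS TWO RESIDUES (night-4, gen 7)

With the `(8, 6)` row in the tree (`GenQEightSixAssembly`: `TraceSumsCore 4, 5`, `HighLayersCoreFree 5, 6`) and the
reduction `rls_succ_succ_of_highLayers 7`, the `(9, 7)` row of C-025 needs exactly `HighLayersCoreFree 7` and
`TraceSumsCore 6`.  THEOREM LARGE₇ (`jq_nonneg_of_large_seven`, coranks `d ≥ 3t + 15` at `t ≤ 5`, `d ≥ 40` at `t = 6`),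
the size chain (`card_le_fCore_of_core`: a rank-`7` flat of the core has `≤ 87` points) and the small-corank lemma
(`Jq_nonneg_of_card_le`: `d ≤ t − 1`) leave of the former exactly the CERTIFICATE RESIDUE
`HighLayersSevenResidue` — the type-`t` balance on the coloop-free rank-`7` flats of rank-`9` Core matroids at the
coranks `t ≤ d ≤ 3t + 14` (`t = 3, 4, 5`: `3 … 23`, `4 … 26`, `5 … 29`) and `6 ≤ d ≤ 39` (`t = 6`;
`sevenResidueBound`): `103` cases.

* `highLayersCoreFree_seven_of_residue : HighLayersSevenResidue → HighLayersCoreFree 7`;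
* **`rls_nine_seven_of_residues : HighLayersSevenResidue → TraceSumsCore 6 → ∀ M, RLS M 9 7`** — the precise
  remaining gap of the diagonal at `(9, 7)`, as two named statements.

Imports `GenQLargeSevenAll`, `GenQCoreChain`, `GenQEightSixAssembly`.
-/
namespace PercRepro.Night4

open Finset ThmH SixFour GenQ PerFlat Star NightThree ThmN

/-- The corank window of the residue at type `t`: `|G| < 3t + 22` for `t ≤ 5`, `|G| < 47` at `t = 6`. -/
def sevenResidueBound (t : ℕ) : ℕ := if t ≤ 5 then 3 * t + 22 else 47

/-- **The certificate residue of `HighLayersCoreFree 7`**: the type-`t` balance (`3 ≤ t ≤ 6`) on the coloop-free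
rank-`7` flats `G` of rank-`9` Core matroids with `7 + t ≤ |G| < sevenResidueBound t` (coranks `t … 3t + 14`, and
`6 … 39` at `t = 6`) — exactly what THEOREM LARGE₇ and the small-corank lemma do not cover. -/
def HighLayersSevenResidue : Prop :=
  ∀ {β : Type} [DecidableEq β] (M : Matroid β) [M.Finite] (G : Finset β), Core M 9 → G ∈ flatsQ M 7 →
    TwoHyp M G 7 → mTr M G = 0 → ∀ t, 3 ≤ t → t ≤ 6 → 7 + t ≤ G.card → G.card < sevenResidueBound t →
      0 ≤ Jq M G 7 t

/-- **`HighLayersCoreFree 7` from its certificate residue**: coranks `≤ t − 1` are demand-free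
(`Jq_nonneg_of_card_le`), `|G| ≥ sevenResidueBound t` is THEOREM LARGE₇ on `|G| ≤ 87` (`card_le_fCore_of_core`),
the rest is the residue. -/
theorem highLayersCoreFree_seven_of_residue (h : HighLayersSevenResidue) : HighLayersCoreFree 7 := by
  intro β _ M _ G hc hG hF hm t ht3 ht
  have h10 := core_flat_four_le_ten M hc
  have hG' := mem_flatsQ.1 hG
  by_cases hsmall : G.card + 1 ≤ 7 + t
  · exact Jq_nonneg_of_card_le (by omega) hsmall
  · by_cases hres : G.card < sevenResidueBound t
    · exact h M G hc hG hF hm t ht3 (by omega) (by omega) hres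
    · have h87 : G.card ≤ 87 := card_le_fCore_of_core hc h10 7 G hG
      unfold sevenResidueBound at hres
      by_cases h5 : t ≤ 5
      · rw [if_pos h5] at hres
        exact jq_nonneg_of_large_seven hc h10 hG'.1 hG'.2.2 ht3 (by omega) (by omega) h87 (Or.inl h5)
      · rw [if_neg h5] at hres
        exact jq_nonneg_of_large_seven hc h10 hG'.1 hG'.2.2 ht3 (by omega) (by omega) h87 (Or.inr (by omega))

/-- **THE `(9, 7)` ROW OF C-025 FROM ITS TWO RESIDUES**: `HighLayersSevenResidue` (the `103` certificate cases) and
`TraceSumsCore 6` (the level-`7` trace sums on the rank-`6` subsets of the core) — everything else is in the tree. -/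
theorem rls_nine_seven_of_residues {γ : Type} [DecidableEq γ] (hres : HighLayersSevenResidue)
    (htr6 : TraceSumsCore 6) (M : Matroid γ) [M.Finite] : RLS M 9 7 := by
  refine rls_succ_succ_of_highLayers 7 (by norm_num) (by norm_num) ?_ ?_ M
  · intro q' h4 h7
    have hq : q' = 4 ∨ q' = 5 ∨ q' = 6 := by omega
    rcases hq with rfl | rfl | rfl
    · intro β _ M _ H hc hH hrH t ht
      exact traceSumsCore_four_of_ten (fun {β} [DecidableEq β] (M : Matroid β) [M.Finite] {p : ℕ} (hc : Core M p) =>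
        core_flat_four_le_ten M hc) M H hc hH hrH t ht
    · intro β _ M _ H hc hH hrH t ht
      exact traceSumsCore_five_of_ten (fun {β} [DecidableEq β] (M : Matroid β) [M.Finite] {p : ℕ} (hc : Core M p) =>
        core_flat_four_le_ten M hc) M H hc hH hrH t ht
    · intro β _ M _ H hc hH hrH t ht
      exact htr6 M H hc hH hrH t ht
  · intro q' h5 h7
    have hq : q' = 5 ∨ q' = 6 ∨ q' = 7 := by omega
    rcases hq with rfl | rfl | rfl
    · intro β _ M _ G hc hG h2 hm t ht3 ht
      exact highLayersCoreFree_five_of_ten (fun {β} [DecidableEq β] (M : Matroid β) [M.Finite] {p : ℕ} (hc : Core M p) =>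
        core_flat_four_le_ten M hc) M G hc hG h2 hm t ht3 ht
    · intro β _ M _ G hc hG h2 hm t ht3 ht
      exact highLayersCoreFree_six_of_ten (fun {β} [DecidableEq β] (M : Matroid β) [M.Finite] {p : ℕ} (hc : Core M p) =>
        core_flat_four_le_ten M hc) M G hc hG h2 hm t ht3 ht
    · intro β _ M _ G hc hG h2 hm t ht3 ht
      exact highLayersCoreFree_seven_of_residue hres M G hc hG h2 hm t ht3 ht

end PercRepro.Night4
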